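import Literature.Claims.NS.Magsanop2026
import Summits.NavierStokesRegularity.NavierStokesRegularity.Theorems.SoloSalvageLucardoOlivaes2026Enstrophy
import Literature.Analysis.FluidPDE.TaoSpeedContinuation
import Literature.Analysis.FluidPDE.CheskidovShvydkoyRegularProofs
import Literature.Analysis.FluidPDE.TaoY6WhitneySum
import Literature.Analysis.FluidPDE.SobolevWholeSpace
import Literature.Analysis.FluidPDE.AxisymNoSwirlTaoBounds
import Mathlib.Analysis.MeanInequalitiesPow
import HarnessLib

/-!
# Solo salvage for claim C145 `Magsanop2026` (cell `ns-claims`, D-0090): the enstrophy differential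
# inequality of §3 (`Step_L22_ineq`) at interior times

Claim C145: skeleton `Literature.Claims.NS.Magsanop2026` (typist-9 g5; ADJUDICATED #132, first failing step
`Step_Thm2`, class false lemma — untouched here). Its `Step_L22_ineq` (§3 p.2 l.48 – p.3 l.16, «d/dt‖ω‖² +
ν‖∇ω‖² ≤ Cν⁻³‖∇u‖⁴‖ω‖²», flagged TRUE-type) asks, along every class solution (`IsSol`: classical on
`[0,T)`, finite energy, smooth `H¹` datum), for continuity of `t ↦ ‖ω(t)‖²_{L²}` on `[0,T)`, differentiability on
`(0,T)` and the display with ONE absolute constant. This file proves the INTERIOR part with the explicit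
constant `C = 4K⁶ + 1` (`K` = Mathlib's Gagliardo–Nirenberg–Sobolev constant `SNormLESNormFDerivOfEqConst` of
`H¹(ℝ³) ⊂ L⁶`; no definitions are introduced — the constant is written out):

* `slice_ineq` — for an `H³`-type field `v` (smooth, `Dv, D²v ∈ L²`): `2∫⟪ω,∇v ω⟫ ≤ ν∫|∇ω|²_F +
  4K⁶ν⁻³(∫|∇v|²_F)²∫|ω|²` (Cauchy–Schwarz, Ladyzhenskaya's `L⁴` inequality
  `SobolevWholeSpace.integral_norm_pow_four_le_of_integrable`, Young `3/4 + 1/4`);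
* `hasDerivAt_vortSq` — along a class solution, at every `t ∈ (0,T)`, `s ↦ ‖ω(s)‖²` has the derivative
  `2(∫⟪ω,∇u ω⟫ − ν∫|∇ω|²_F)`: the class solution is, away from `t = 0`, a Chae/BKM-class solution (Tao 2013
  Cor. 11.1 in the tree: `hasBoundedSobolevNormsOn_pos_of_finiteEnergy` with the PROVED
  `tao2011_H1_local_almost_regular_holds` / `tao2011_enstrophyLocalisation_exterior_apriori_holds`), to
  whose time-translate the C137 identity `…Theorems.LucardoOlivaes2026.hasDerivAt_half_ensq` applies;
* `step_L22_ineq_interior` — hence `DifferentiableAt` and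
  `deriv ‖ω‖² + ν‖∇ω‖² ≤ 4K⁶ν⁻³‖∇u‖⁴‖ω‖²` at every interior time, in the skeleton's vocabulary.

The remaining clause of `Step_L22_ineq` — continuity of `‖ω(t)‖²` at `t = 0⁺` for a datum that is only
`H¹ ∩ C^∞` — is NOT proved here (it needs the `H¹`-continuity of Leray's semi-strong solution at the initial
time plus identification); see the seat's bus line. Salvage seat `ns-claims-salvage-p1` g4 (cross-row TRUE
column, announce-first 14:31Z; C145 salvage of record is salvage-p4). Nothing disputed is asserted.

WHAT THIS IS NOT: not a claim about NS regularity or blow-up; not a claim about any author beyond the typed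
locator.
-/

set_option linter.dupNamespace false

noncomputable section

open Set Filter MeasureTheory Topology InnerProductSpace
open scoped RealInnerProductSpace ENNReal NNReal ContDiff

namespace Summit.NavierStokesRegularity.NavierStokesRegularity.Theorems.Magsanop2026Enstrophy

open Literature.Analysis.FluidPDE
open Literature.Claims.NS.Magsanop2026 (E3 IsSol IsDatum vortSq gradSq Step_L22_ineq)
open Literature.Claims.NS.LucardoOlivaes2026 (ensq stretchI)
open Literature.Claims.NS.Chae2007 (IsLocalSolution)

/-- `0 ≤ K` for Mathlib's Gagliardo–Nirenberg–Sobolev constant `K` of `‖v‖_{L⁶(ℝ³)} ≤ K‖Dv‖_{L²}` (the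
constant of this file is `C = 4K⁶ + 1`, written out in every statement). [cite: Evans2010, §5.6.1 Thm. 1–2] -/
theorem K6_nonneg : 0 ≤ (SNormLESNormFDerivOfEqConst E3 (volume : Measure E3) 2 : ℝ) :=
  NNReal.coe_nonneg _

/-- `0 < C = 4K⁶ + 1`. [folklore] -/
theorem C22_pos : 0 < 4 * (SNormLESNormFDerivOfEqConst E3 (volume : Measure E3) 2 : ℝ) ^ 6 + 1 := by
  positivity

/-! ## 1. The slice inequality -/

/-- **Young's inequality with exponents `4/3`, `4`**: for `a, P ≥ 0` and `ν > 0`,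
`a·P^{3/4} ≤ (3/4)νP + (1/4)a⁴ν⁻³` (weighted AM–GM). [folklore] -/
theorem young_three_quarters {a P ν : ℝ} (ha : 0 ≤ a) (hP : 0 ≤ P) (hν : 0 < ν) :
    a * P ^ (3 / 4 : ℝ) ≤ 3 / 4 * (ν * P) + 1 / 4 * (a ^ 4 / ν ^ 3) := by
  have h := Real.geom_mean_le_arith_mean2_weighted (w₁ := 3 / 4) (w₂ := 1 / 4) (p₁ := ν * P)
    (p₂ := a ^ 4 / ν ^ 3) (by norm_num) (by norm_num) (by positivity) (by positivity) (by norm_num)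
  have hid : (ν * P) ^ (3 / 4 : ℝ) * (a ^ 4 / ν ^ 3) ^ (1 / 4 : ℝ) = a * P ^ (3 / 4 : ℝ) := by
    rw [Real.mul_rpow hν.le hP, Real.div_rpow (by positivity) (by positivity),
      show (1 / 4 : ℝ) = ((4 : ℕ) : ℝ)⁻¹ by norm_num, Real.pow_rpow_inv_natCast ha (by norm_num),
      ← Real.rpow_natCast ν 3, ← Real.rpow_mul hν.le]
    have hν34 : (ν : ℝ) ^ ((3 : ℕ) * ((4 : ℕ) : ℝ)⁻¹ : ℝ) = ν ^ (3 / 4 : ℝ) := by norm_num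
    rw [hν34]
    have hνpos : 0 < ν ^ (3 / 4 : ℝ) := Real.rpow_pos_of_pos hν _
    field_simp
  rw [hid] at h
  exact h

/-- Pointwise: `|⟪ω, ∇v ω⟫| ≤ ‖ω‖²‖∇v‖`. [folklore] -/
theorem abs_inner_stretch_le (v : E3 → E3) (x : E3) :
    |⟪curl v x, fderiv ℝ v x (curl v x)⟫| ≤ ‖curl v x‖ ^ 2 * ‖fderiv ℝ v x‖ := by
  calc |⟪curl v x, fderiv ℝ v x (curl v x)⟫| ≤ ‖curl v x‖ * ‖fderiv ℝ v x (curl v x)‖ :=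
        abs_real_inner_le_norm _ _
    _ ≤ ‖curl v x‖ * (‖fderiv ℝ v x‖ * ‖curl v x‖) := by
        gcongr; exact ContinuousLinearMap.le_opNorm _ _
    _ = ‖curl v x‖ ^ 2 * ‖fderiv ℝ v x‖ := by ring

variable {v : E3 → E3}

/-- Integrability package of an `H³`-type slice: `‖ω‖², ‖ω‖⁴, ‖ω‖⁶, ‖Dω‖², |Dω|²_F, ‖Dv‖², |Dv|²_F ∈ L¹`.
[folklore] -/
theorem slice_integrable (hv : ContDiff ℝ 3 v)
    (h1 : ∫⁻ x, ‖iteratedFDeriv ℝ 1 v x‖ₑ ^ 2 < ⊤) (h2 : ∫⁻ x, ‖iteratedFDeriv ℝ 2 v x‖ₑ ^ 2 < ⊤) :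
    Integrable (fun x => ‖curl v x‖ ^ 2) ∧ Integrable (fun x => ‖fderiv ℝ (curl v) x‖ ^ 2) ∧
    Integrable (fun x => frobeniusNormSq (fderiv ℝ (curl v) x)) ∧
    Integrable (fun x => ‖curl v x‖ ^ 6) ∧ Integrable (fun x => ‖curl v x‖ ^ 4) ∧
    Integrable (fun x => ‖fderiv ℝ v x‖ ^ 2) ∧ Integrable (fun x => frobeniusNormSq (fderiv ℝ v x)) := by
  have hv2 : ContDiff ℝ 2 v := hv.of_le (by norm_cast)
  have hv1 : ContDiff ℝ 1 v := hv.of_le (by norm_cast)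
  have hω1 : ContDiff ℝ 1 (curl v) := contDiff_curl (n := 1) (by exact_mod_cast hv2)
  have hωc : Continuous (curl v) := hω1.continuous
  -- `‖ω‖²`
  have I2 : Integrable (fun x => ‖curl v x‖ ^ 2) := (integrable_norm_curl_sq hv2 h1).1
  -- `|Dω|²_F` and `‖Dω‖²`
  have IF : Integrable (fun x => frobeniusNormSq (fderiv ℝ (curl v) x)) :=
    (integrable_frobeniusNormSq_fderiv_curl hv h2).1
  have hDωc : Continuous (fderiv ℝ (curl v)) := hω1.continuous_fderiv one_ne_zero
  have ID : Integrable (fun x => ‖fderiv ℝ (curl v) x‖ ^ 2) :=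
    IF.mono' (hDωc.norm.pow 2).aestronglyMeasurable (ae_of_all _ fun x => by
      rw [Real.norm_eq_abs, abs_of_nonneg (sq_nonneg _)]; exact norm_sq_le_frobeniusNormSq _)
  -- `‖Dv‖²`, `|Dv|²_F`
  have hDvc : Continuous (fderiv ℝ v) := hv1.continuous_fderiv one_ne_zero
  have h1' : ∫⁻ x, ‖fderiv ℝ v x‖ₑ ^ 2 < ⊤ := by
    refine lt_of_le_of_lt (le_of_eq (lintegral_congr fun x => ?_)) h1
    rw [← ofReal_norm, ← norm_iteratedFDeriv_one (𝕜 := ℝ) (f := v), ofReal_norm]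
  have IDv : Integrable (fun x => ‖fderiv ℝ v x‖ ^ 2) := integrable_sq_norm_of_lintegral_lt_top hDvc h1'
  have IFv : Integrable (fun x => frobeniusNormSq (fderiv ℝ v x)) := by
    refine (IDv.const_mul 3).mono' (continuous_frobeniusNormSq_fderiv hv1 one_ne_zero).aestronglyMeasurable
      (ae_of_all _ fun x => ?_)
    rw [Real.norm_eq_abs, abs_of_nonneg (frobeniusNormSq_nonneg _)]
    exact frobeniusNormSq_le_three_mul _
  -- `‖ω‖⁶` by the Sobolev embedding `H¹ ⊂ L⁶`
  have m2 : MemLp (curl v) 2 volume := (memLp_two_iff_integrable_sq_norm hωc.aestronglyMeasurable).2 I2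
  have mD : MemLp (fderiv ℝ (curl v)) 2 volume :=
    (memLp_two_iff_integrable_sq_norm hDωc.aestronglyMeasurable).2 ID
  have hsob := eLpNorm_six_le_eLpNorm_fderiv_two (volume : Measure E3) finrank_euclideanSpace_fin hω1
    m2.eLpNorm_lt_top
  have m6 : MemLp (curl v) 6 volume :=
    ⟨hωc.aestronglyMeasurable, lt_of_le_of_lt hsob (ENNReal.mul_lt_top ENNReal.coe_lt_top mD.eLpNorm_lt_top)⟩
  have I6 : Integrable (fun x => ‖curl v x‖ ^ 6) := by
    have h := m6.integrable_norm_rpow (by norm_num) (by norm_num)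
    refine h.congr (ae_of_all _ fun x => ?_)
    simp only [ENNReal.toReal_ofNat]
    rw [show (6 : ℝ) = ((6 : ℕ) : ℝ) by norm_num, Real.rpow_natCast]
  -- `‖ω‖⁴ ≤ ‖ω‖² + ‖ω‖⁶`
  have I4 : Integrable (fun x => ‖curl v x‖ ^ 4) := by
    refine (I2.add I6).mono' (hωc.norm.pow 4).aestronglyMeasurable (ae_of_all _ fun x => ?_)
    simp only [Pi.add_apply]
    rw [Real.norm_eq_abs, abs_of_nonneg (by positivity)]
    have h0 : 0 ≤ ‖curl v x‖ := norm_nonneg _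
    nlinarith [mul_nonneg (sq_nonneg (‖curl v x‖ ^ 2 - 1)) (sq_nonneg ‖curl v x‖), pow_nonneg h0 2]
  exact ⟨I2, ID, IF, I6, I4, IDv, IFv⟩

/-- **Cauchy–Schwarz for the stretching**: `|∫⟪ω,∇v ω⟫| ≤ √(∫‖ω‖⁴) √(∫|∇v|²_F)`. [folklore] -/
theorem abs_stretchI_le (hv : ContDiff ℝ 3 v)
    (h1 : ∫⁻ x, ‖iteratedFDeriv ℝ 1 v x‖ₑ ^ 2 < ⊤) (h2 : ∫⁻ x, ‖iteratedFDeriv ℝ 2 v x‖ₑ ^ 2 < ⊤) :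
    |stretchI v| ≤ Real.sqrt (∫ x, ‖curl v x‖ ^ 4) * Real.sqrt (gradSq v) := by
  obtain ⟨I2, ID, IF, I6, I4, IDv, IFv⟩ := slice_integrable hv h1 h2
  have hv1 : ContDiff ℝ 1 v := hv.of_le (by norm_cast)
  have hωc : Continuous (curl v) := (contDiff_curl (n := 1) (by exact_mod_cast (hv.of_le (by norm_cast) :
    ContDiff ℝ 2 v))).continuous
  have hDvc : Continuous (fderiv ℝ v) := hv1.continuous_fderiv one_ne_zero
  -- `|∫| ≤ ∫ ‖ω‖² ‖Dv‖`
  have hprod : Integrable (fun x => ‖curl v x‖ ^ 2 * ‖fderiv ℝ v x‖) := by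
    have mf : MemLp (fun x => ‖curl v x‖ ^ 2) 2 volume := by
      refine (memLp_two_iff_integrable_sq_norm (hωc.norm.pow 2).aestronglyMeasurable).2 ?_
      refine I4.congr (ae_of_all _ fun x => ?_)
      show ‖curl v x‖ ^ 4 = ‖‖curl v x‖ ^ 2‖ ^ 2
      rw [Real.norm_eq_abs, abs_of_nonneg (sq_nonneg _)]; ring
    have mg : MemLp (fun x => ‖fderiv ℝ v x‖) 2 volume :=
      (memLp_two_iff_integrable_sq_norm hDvc.norm.aestronglyMeasurable).2
        (IDv.congr (ae_of_all _ fun x => by simp only [norm_norm]))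
    exact mf.integrable_mul mg
  have hS : |stretchI v| ≤ ∫ x, ‖curl v x‖ ^ 2 * ‖fderiv ℝ v x‖ := by
    unfold stretchI
    refine (abs_integral_le_integral_abs).trans (integral_mono_of_nonneg (ae_of_all _ fun x => abs_nonneg _)
      hprod (ae_of_all _ fun x => abs_inner_stretch_le v x))
  -- Hölder `2,2`
  have hH := integral_mul_le_Lp_mul_Lq_of_nonneg (μ := (volume : Measure E3)) Real.HolderConjugate.two_two
    (f := fun x => ‖curl v x‖ ^ 2) (g := fun x => ‖fderiv ℝ v x‖)
    (ae_of_all _ fun x => by positivity) (ae_of_all _ fun x => norm_nonneg _)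
    (by
      rw [ENNReal.ofReal_ofNat]
      refine (memLp_two_iff_integrable_sq_norm (hωc.norm.pow 2).aestronglyMeasurable).2 ?_
      refine I4.congr (ae_of_all _ fun x => ?_)
      show ‖curl v x‖ ^ 4 = ‖‖curl v x‖ ^ 2‖ ^ 2
      rw [Real.norm_eq_abs, abs_of_nonneg (sq_nonneg _)]; ring)
    (by
      rw [ENNReal.ofReal_ofNat]
      exact (memLp_two_iff_integrable_sq_norm hDvc.norm.aestronglyMeasurable).2
        (IDv.congr (ae_of_all _ fun x => by simp only [norm_norm])))
  have e1 : ∫ x, (‖curl v x‖ ^ 2) ^ (2 : ℝ) = ∫ x, ‖curl v x‖ ^ 4 :=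
    integral_congr_ae (ae_of_all _ fun x => by
      show (‖curl v x‖ ^ 2) ^ (2 : ℝ) = ‖curl v x‖ ^ 4
      rw [Real.rpow_two]; ring)
  have e2 : ∫ x, ‖fderiv ℝ v x‖ ^ (2 : ℝ) = ∫ x, ‖fderiv ℝ v x‖ ^ 2 :=
    integral_congr_ae (ae_of_all _ fun x => by
      show ‖fderiv ℝ v x‖ ^ (2 : ℝ) = ‖fderiv ℝ v x‖ ^ 2
      rw [Real.rpow_two])
  rw [e1, e2] at hH
  have hGop : ∫ x, ‖fderiv ℝ v x‖ ^ 2 ≤ gradSq v := by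
    unfold gradSq VectorCalculus.gradNormSq
    exact integral_mono IDv IFv fun x => norm_sq_le_frobeniusNormSq _
  calc |stretchI v| ≤ ∫ x, ‖curl v x‖ ^ 2 * ‖fderiv ℝ v x‖ := hS
    _ ≤ (∫ x, ‖curl v x‖ ^ 4) ^ (1 / (2 : ℝ)) * (∫ x, ‖fderiv ℝ v x‖ ^ 2) ^ (1 / (2 : ℝ)) := hH
    _ = Real.sqrt (∫ x, ‖curl v x‖ ^ 4) * Real.sqrt (∫ x, ‖fderiv ℝ v x‖ ^ 2) := by
        rw [Real.sqrt_eq_rpow, Real.sqrt_eq_rpow]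
    _ ≤ Real.sqrt (∫ x, ‖curl v x‖ ^ 4) * Real.sqrt (gradSq v) := by
        gcongr

/-- **Ladyzhenskaya for the vorticity**: `∫‖ω‖⁴ ≤ K³ √(∫‖ω‖²) (∫|∇ω|²_F)^{3/2}`. [cite: Evans2010, §5.6.1 Thm. 1–2] -/
theorem integral_curl_pow_four_le (hv : ContDiff ℝ 3 v)
    (h1 : ∫⁻ x, ‖iteratedFDeriv ℝ 1 v x‖ₑ ^ 2 < ⊤) (h2 : ∫⁻ x, ‖iteratedFDeriv ℝ 2 v x‖ₑ ^ 2 < ⊤) :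
    ∫ x, ‖curl v x‖ ^ 4 ≤ (SNormLESNormFDerivOfEqConst E3 (volume : Measure E3) 2 : ℝ) ^ 3 *
      Real.sqrt (vortSq v) * (gradSq (curl v)) ^ (3 / 2 : ℝ) := by
  obtain ⟨I2, ID, IF, I6, I4, IDv, IFv⟩ := slice_integrable hv h1 h2
  have hω1 : ContDiff ℝ 1 (curl v) := contDiff_curl (n := 1) (by exact_mod_cast (hv.of_le (by norm_cast) :
    ContDiff ℝ 2 v))
  have hL := integral_norm_pow_four_le_of_integrable (volume : Measure E3) finrank_euclideanSpace_fin hω1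
    I2 I6 ID
  have hPop : ∫ x, ‖fderiv ℝ (curl v) x‖ ^ 2 ≤ gradSq (curl v) := by
    unfold gradSq VectorCalculus.gradNormSq
    exact integral_mono ID IF fun x => norm_sq_le_frobeniusNormSq _
  have hP0 : 0 ≤ ∫ x, ‖fderiv ℝ (curl v) x‖ ^ 2 := integral_nonneg fun x => by positivity
  calc ∫ x, ‖curl v x‖ ^ 4
      ≤ (SNormLESNormFDerivOfEqConst E3 (volume : Measure E3) 2 : ℝ) ^ 3 * (∫ x, ‖curl v x‖ ^ 2) ^ (1 / 2 : ℝ) *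
          (∫ x, ‖fderiv ℝ (curl v) x‖ ^ 2) ^ (3 / 2 : ℝ) := hL
    _ ≤ (SNormLESNormFDerivOfEqConst E3 (volume : Measure E3) 2 : ℝ) ^ 3 * Real.sqrt (vortSq v) *
          (gradSq (curl v)) ^ (3 / 2 : ℝ) := by
        rw [← Real.sqrt_eq_rpow]
        have hK : 0 ≤ (SNormLESNormFDerivOfEqConst E3 (volume : Measure E3) 2 : ℝ) ^ 3 :=
          pow_nonneg K6_nonneg 3
        gcongr
        exact le_rfl

/-- **The slice inequality** (§3 p.3 l.6–16 «Hölder … Ladyzhenskaya … Young»): for a smooth field with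
`Dv, D²v ∈ L²`, `2∫⟪ω,∇v ω⟫ ≤ ν∫|∇ω|²_F + C ν⁻³ (∫|∇v|²_F)² ∫|ω|²` with `C = 4K⁶ + 1`.
[cite: Magsanop2026, §3 p.3 l.6–16] [cite: Evans2010, §5.6.1 Thm. 1–2] -/
theorem slice_ineq {ν : ℝ} (hν : 0 < ν) (hv : ContDiff ℝ 3 v)
    (h1 : ∫⁻ x, ‖iteratedFDeriv ℝ 1 v x‖ₑ ^ 2 < ⊤) (h2 : ∫⁻ x, ‖iteratedFDeriv ℝ 2 v x‖ₑ ^ 2 < ⊤) :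
    2 * stretchI v ≤ ν * gradSq (curl v) + (4 * (SNormLESNormFDerivOfEqConst E3 (volume : Measure E3) 2 : ℝ) ^ 6 + 1) * ν⁻¹ ^ 3 * gradSq v ^ 2 * vortSq v := by
  set K6 : ℝ := (SNormLESNormFDerivOfEqConst E3 (volume : Measure E3) 2 : ℝ) with hK6
  set P : ℝ := gradSq (curl v) with hP
  set G : ℝ := gradSq v with hG
  set V : ℝ := vortSq v with hV
  have hP0 : 0 ≤ P := integral_nonneg fun x => frobeniusNormSq_nonneg _
  have hG0 : 0 ≤ G := integral_nonneg fun x => frobeniusNormSq_nonneg _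
  have hV0 : 0 ≤ V := integral_nonneg fun x => by positivity
  have hS := abs_stretchI_le hv h1 h2
  have hL := integral_curl_pow_four_le hv h1 h2
  rw [← hP, ← hV] at hL
  rw [← hG] at hS
  -- `|S| ≤ a/2 · P^{3/4}` with `a = 2 √(K³ √V) √G`
  set a : ℝ := 2 * Real.sqrt (K6 ^ 3 * Real.sqrt V) * Real.sqrt G with ha
  have hKV : 0 ≤ K6 ^ 3 * Real.sqrt V := mul_nonneg (pow_nonneg K6_nonneg 3) (Real.sqrt_nonneg _)
  have ha0 : 0 ≤ a := by rw [ha]; positivity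
  have hsqrt4 : Real.sqrt (∫ x, ‖curl v x‖ ^ 4) ≤ Real.sqrt (K6 ^ 3 * Real.sqrt V) * P ^ (3 / 4 : ℝ) := by
    calc Real.sqrt (∫ x, ‖curl v x‖ ^ 4) ≤ Real.sqrt (K6 ^ 3 * Real.sqrt V * P ^ (3 / 2 : ℝ)) :=
          Real.sqrt_le_sqrt hL
      _ = Real.sqrt (K6 ^ 3 * Real.sqrt V) * P ^ (3 / 4 : ℝ) := by
          rw [Real.sqrt_mul hKV, Real.sqrt_eq_rpow (P ^ (3 / 2 : ℝ)), ← Real.rpow_mul hP0]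
          norm_num
  have h2S : 2 * |stretchI v| ≤ a * P ^ (3 / 4 : ℝ) := by
    calc 2 * |stretchI v| ≤ 2 * (Real.sqrt (∫ x, ‖curl v x‖ ^ 4) * Real.sqrt G) := by linarith
      _ ≤ 2 * (Real.sqrt (K6 ^ 3 * Real.sqrt V) * P ^ (3 / 4 : ℝ) * Real.sqrt G) := by
          gcongr
      _ = a * P ^ (3 / 4 : ℝ) := by rw [ha]; ring
  have hY := young_three_quarters ha0 hP0 hν
  -- `a⁴ = 16 K⁶ V G²`
  have ha4 : a ^ 4 = 16 * K6 ^ 6 * V * G ^ 2 := by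
    have hsq : a ^ 2 = 4 * (K6 ^ 3 * Real.sqrt V) * G := by
      rw [ha, mul_pow, mul_pow, Real.sq_sqrt hKV, Real.sq_sqrt hG0]; ring
    calc a ^ 4 = (a ^ 2) ^ 2 := by ring
      _ = (4 * (K6 ^ 3 * Real.sqrt V) * G) ^ 2 := by rw [hsq]
      _ = 16 * K6 ^ 6 * (Real.sqrt V) ^ 2 * G ^ 2 := by ring
      _ = 16 * K6 ^ 6 * V * G ^ 2 := by rw [Real.sq_sqrt hV0]
  have hle : 2 * stretchI v ≤ 3 / 4 * (ν * P) + 1 / 4 * (a ^ 4 / ν ^ 3) :=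
    le_trans (by linarith [le_abs_self (stretchI v)]) (h2S.trans hY)
  rw [ha4] at hle
  have hν3 : 0 < ν ^ 3 := pow_pos hν 3
  have hinv : ν⁻¹ ^ 3 = (ν ^ 3)⁻¹ := by rw [inv_pow]
  rw [hinv]
  have hextra : 0 ≤ (4 * K6 ^ 6 + 1) * (ν ^ 3)⁻¹ * G ^ 2 * V - 1 / 4 * (16 * K6 ^ 6 * V * G ^ 2 / ν ^ 3) := by
    have : (4 * K6 ^ 6 + 1) * (ν ^ 3)⁻¹ * G ^ 2 * V - 1 / 4 * (16 * K6 ^ 6 * V * G ^ 2 / ν ^ 3) =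
        G ^ 2 * V / ν ^ 3 := by field_simp; ring
    rw [this]; positivity
  nlinarith [mul_nonneg hν.le hP0]

/-! ## 2. Class solutions away from `t = 0` are Chae/BKM-class; the derivative of `‖ω‖²` -/

variable {ν T : ℝ} {u₀ : E3 → E3} {u : ℝ → E3 → E3} {p : ℝ → E3 → ℝ}

/-- **Interior Sobolev regularity of a class solution** (Tao 2013, Cor. 11.1, in the tree): for `0 < σ < T' < T`
all `L²` Sobolev norms of `u` are bounded on `[σ, T']`. [cite: Tao2011, Cor. 11.1] -/
theorem hasBoundedSobolevNormsOn_interior (hν : 0 < ν) (hsol : IsSol ν T u₀ u p) {σ T' : ℝ} (hσ : 0 < σ)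
    (hσT' : σ < T') (hT' : T' < T) : HasBoundedSobolevNormsOn (Icc σ T') u := by
  have hT'0 : 0 < T' := hσ.trans hσT'
  have hcl : IsClassicalNSSolutionOn (Icc 0 T') ν 0 u p :=
    hsol.classical.mono (Icc_subset_Ico_right hT') (uniqueDiffOn_Icc hT'0)
  have hfe : ∃ C : ℝ≥0∞, C < ⊤ ∧ ∀ t ∈ Icc 0 T', ∫⁻ x, ‖u t x‖ₑ ^ 2 ≤ C := by
    obtain ⟨A, hA, hAt⟩ := hsol.energy
    exact ⟨A, hA, fun t ht => hAt t ⟨ht.1, ht.2.trans_lt hT'⟩⟩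
  obtain ⟨c, hc, hreg⟩ := tao2011_H1_local_almost_regular_holds
  exact hasBoundedSobolevNormsOn_pos_of_finiteEnergy hc hreg tao2011_enstrophyLocalisation_exterior_apriori_holds
    hν hT'0 hcl hfe hσ hσT'

/-- **The time-translate `s ↦ u(s + σ)` of a class solution is a Chae/BKM-class local solution on
`[0, T' − σ)`** for `0 < σ < T' < T`. [cite: Tao2011, Cor. 11.1] -/
theorem isLocalSolution_translate (hν : 0 < ν) (hsol : IsSol ν T u₀ u p) {σ T' : ℝ} (hσ : 0 < σ)
    (hσT' : σ < T') (hT' : T' < T) :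
    IsLocalSolution ν (T' - σ) (u σ) (fun s => u (s + σ)) (fun s => p (s + σ)) where
  isClassical := by
    have h := hsol.classical.comp_add_right σ
    refine h.mono (fun s hs => ?_) (uniqueDiffOn_Ico 0 (T' - σ))
    exact ⟨by linarith [hs.1], by linarith [hs.2]⟩
  initial := by simp
  sobolev := by
    intro T'' hT''
    have hB := hasBoundedSobolevNormsOn_interior hν hsol hσ hσT' hT'
    intro n
    obtain ⟨C, hC⟩ := hB n
    exact ⟨C, fun s hs => hC (s + σ) ⟨by linarith [hs.1], by linarith [hs.2]⟩⟩

/-- **The derivative of `‖ω(t)‖²_{L²}` at interior times**: along a class solution with `ν > 0`, at every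
`t ∈ (0,T)`, `d/ds ∫|curl u(s)|² = 2(∫⟪ω,∇u ω⟫ − ν∫|∇ω|²_F)` (the enstrophy identity §3 p.2 l.48–p.3 l.5, via the
C137 kernel identity `…LucardoOlivaes2026.hasDerivAt_half_ensq` on the translate). [cite: Magsanop2026, §3 p.2 l.48 – p.3 l.5] -/
theorem hasDerivAt_vortSq (hν : 0 < ν) (hsol : IsSol ν T u₀ u p) {t : ℝ} (ht : t ∈ Ioo 0 T) :
    HasDerivAt (fun s => vortSq (u s))
      (2 * (stretchI (u t) - ν * gradSq (curl (u t)))) t := by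
  set σ : ℝ := t / 2 with hσ
  set T' : ℝ := (t + T) / 2 with hT'
  have hσ0 : 0 < σ := by rw [hσ]; linarith [ht.1]
  have hσT' : σ < T' := by rw [hσ, hT']; linarith [ht.1, ht.2]
  have hT'T : T' < T := by rw [hT']; linarith [ht.2]
  have hLS := isLocalSolution_translate hν hsol hσ0 hσT' hT'T
  have htσ : t - σ ∈ Ioo 0 (T' - σ) := ⟨by rw [hσ]; linarith [ht.1], by rw [hσ, hT']; linarith [ht.2]⟩
  have hD := Summit.NavierStokesRegularity.NavierStokesRegularity.Theorems.LucardoOlivaes2026.hasDerivAt_half_ensq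
    hν hLS htσ
  simp only [sub_add_cancel] at hD
  -- back to the original time variable
  have hD' : HasDerivAt (fun s => (1 / 2 : ℝ) * ensq (fun s => u (s + σ)) (s - σ))
      (stretchI (u t) - ν * ∫ x, frobeniusNormSq (fderiv ℝ (curl (u t)) x)) t :=
    hD.comp_sub_const t σ
  have hfun : (fun s => (1 / 2 : ℝ) * ensq (fun s => u (s + σ)) (s - σ)) = fun s => (1 / 2 : ℝ) * vortSq (u s) := by
    funext s
    simp only [ensq, sub_add_cancel]
    rfl
  rw [hfun] at hD'
  have h2 := hD'.const_mul 2
  have hfun2 : (fun s => 2 * ((1 / 2 : ℝ) * vortSq (u s))) = fun s => vortSq (u s) := by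
    funext s; ring
  rw [hfun2] at h2
  exact h2.congr_deriv rfl

/-- **`Step_L22_ineq` at interior times**: along a class solution with `ν > 0`, at every `t ∈ (0,T)`,
`s ↦ ‖ω(s)‖²` is differentiable and `d/dt‖ω‖² + ν‖∇ω‖²_{L²} ≤ C ν⁻³ ‖∇u‖⁴_{L²} ‖ω‖²_{L²}` with `C = 4K⁶ + 1`.
[cite: Magsanop2026, §3 p.2 l.48 – p.3 l.16] -/
theorem step_L22_ineq_interior (hν : 0 < ν) (hsol : IsSol ν T u₀ u p) {t : ℝ} (ht : t ∈ Ioo 0 T) :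
    DifferentiableAt ℝ (fun s => vortSq (u s)) t ∧
      deriv (fun s => vortSq (u s)) t + ν * gradSq (curl (u t)) ≤
        (4 * (SNormLESNormFDerivOfEqConst E3 (volume : Measure E3) 2 : ℝ) ^ 6 + 1) * ν⁻¹ ^ 3 * gradSq (u t) ^ 2 *
          vortSq (u t) := by
  have hD := hasDerivAt_vortSq hν hsol ht
  refine ⟨hD.differentiableAt, ?_⟩
  rw [hD.deriv]
  -- regularity of the slice `u t`
  set σ : ℝ := t / 2
  set T' : ℝ := (t + T) / 2
  have hσ0 : 0 < σ := by show 0 < t / 2; linarith [ht.1]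
  have hσT' : σ < T' := by show t / 2 < (t + T) / 2; linarith [ht.1, ht.2]
  have hT'T : T' < T := by show (t + T) / 2 < T; linarith [ht.2]
  have hB := hasBoundedSobolevNormsOn_interior hν hsol hσ0 hσT' hT'T
  have htI : t ∈ Icc σ T' := ⟨by show t / 2 ≤ t; linarith [ht.1], by show t ≤ (t + T) / 2; linarith [ht.2]⟩
  have hn : ∀ n : ℕ, ∫⁻ x, ‖iteratedFDeriv ℝ n (u t) x‖ₑ ^ 2 < ⊤ := fun n => by
    obtain ⟨C, hC⟩ := hB n
    exact (hC t htI).trans_lt ENNReal.coe_lt_top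
  have hsm : ContDiff ℝ 3 (u t) := (hsol.classical.contDiff_velocity ⟨ht.1.le, ht.2⟩).of_le (by norm_cast)
  have hS := slice_ineq hν hsm (hn 1) (hn 2)
  have hP0 : 0 ≤ gradSq (curl (u t)) := integral_nonneg fun x => frobeniusNormSq_nonneg _
  nlinarith [mul_nonneg hν.le hP0]

end Summit.NavierStokesRegularity.NavierStokesRegularity.Theorems.Magsanop2026Enstrophy

end
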